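/-
Copyright (c) 2026 the pub-hodgecm-mathlib formalisation cell (harness21).  Prover seat hodgecm-mathlib-LH7-p10 (g3), req620 Track A «(D-RAM) FOUR-FRAME» squad
((β₂) road (R-36) «PURE-CELL LEDGER», the MIX-HI family (β₂ WORD #34 ∕ #36 ‹PRODBAL›): the E-SIDE KERNEL asked by the MIX-HI lead LH4-p13 (g10) 02:59Z «LH7-p10: E-kernel = YES»),
helper lane on h413 = stmt-HodgeConjecture-24833 (count-neutral).  2026-09-05.
-/
import Summits.HodgeConjecture.HodgeConjecture.Theorems.F0P3cDyRamRayScalarGluePairing   -- ★ p864387 (this seat): HEAD′ `rayScalar_eq_pairing_mul_affine`, `map_affine_eq_self`, `kappaHat_add_map`; brings ★ `map_glueNorm_eq`, ★ DEFS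
import HarnessLib

/-!
# Crux `H413`, line LH4 «(D-RAM) FOUR-FRAME» — the (β₂) road (R-36), MIX-HI family: «THE E-SIDE KERNEL OF THE PRODUCT READ» — at a presentation `x₀` of a cone-cell member,
# ON `E`: the ray scalar is `e₀ = ⟨w₀,w₀⟩·a` with `jE a = ρμ + (μ − ρμ)κ̂`; the glue unit is `r₀ = −⟨w₀,w₀⟩·(ϖ^b σϖ^b)∕h_W`; hence for any fixed unit `e′` the product class reads
# `r₀·e′ ∈ N(E^×) ⟺ −(e′∕⟨w₀,w₀⟩)∕h_W ∈ N(E^×)`, and the exact-level digit reads `|e₀| = |ϖ|^{ℓ₀} ⟺ |⟨w₀,w₀⟩·a| = |ϖ|^{ℓ₀}`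

Cell `hodgecm-mathlib` (D-0151), FLOOR 0, crux item H413 = `stmt-HodgeConjecture-24833`, route of record `HCCMUnconditional`; squads F0∕P3c∕LH4 ∕ LH7; lane
`--supports stmt-HodgeConjecture-24833 --as helper` (count-neutral; pays NO tier-0 row).  THEOREMS ONLY (no `def`, no instance, no notation, no `sorry`, default heartbeats);
★-only imports; states NO law; the MIX-HI letters, ‹PRODBAL-U∕D∕L›, (OFF), (ROW), (β₂) stay HYPOTHESES.  DATUM-FREE, LANE-FREE field algebra: ★ (C1)'s line model `(M, jE, ρ, Θ; φ, h)`
(`ρ, Θ` commuting involutions, `Θh = h ≠ 0`, `Fix ρ = jE(E)`, `Θ∘jE = jE∘σ`), `σ` an involution of `E`, a cell scalar `cc` (`ρcc = cc ≠ 0`), `Y = dualGen ρ Θ α cc h x₀`, the canonical plane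
datum `φw₀ = Y⁻¹x₀`, the ray-scalar letter `jE e₀ = Tr_ρ(μ∕(cc(α − ρα)·ΘY))`, the glue letter `jE r₀ = glueUnit ρ Θ α cc h (jE ϖ) (jE h_W) x₀ b`.

WHY (MIX-HI lead LH4-p13 (g10) 2026-09-05T02:59:03Z + MIXHI-DIGIT-READING v2 (LH-1)): ★ p864839 `…MixBandProductClassOfMember.exactDigit_and_prodClass_of_presentation` reads the
letters' `NX Λ` and `Pc Λ` AT ANY presentation `x₀`: (a) `NX Λ ↔ |e₀| = |ϖ|^{d%2}`, (b) `Pc Λ ↔ ∃ c, cσc = r₀·e′` for any σ-fixed unit `e′` with `|e₀ − e′t₊| ≤ |ϖ|^{m⋆}`.  THIS FILE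
turns both right-hand sides into functions of the DIGIT through the glue pairing `pw := ⟨w₀,w₀⟩ ∈ F^×` (★ p864387: `e₀ = pw·ℓ`, `jE ℓ = ρμ + (μ−ρμ)κ̂`, EVERY lane, EVERY cell):
* §1 `exists_affine_preimage` — `ρμ + (μ − ρμ)·κ̂ ∈ jE(E)` (`κ̂ = ρu₀∕Tr_ρu₀`, ★ `map_affine_eq_self` + `kappaHat_add_map`); HEAD 1 `rayScalar_eq_pairing_mul_on_E` — **`∃ a, jE a =
  ρμ + (μ − ρμ)κ̂ ∧ e₀ = ⟨w₀,w₀⟩·a`** (★ HEAD′ pulled back along the injective `jE`); so `|e₀| = |⟨w₀,w₀⟩|·|a|` and the exact-level digit (a) is `|⟨w₀,w₀⟩·a| = |ϖ|^{ℓ₀}`.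
* §2 `glueUnitE_eq` — **`r₀ = −⟨w₀,w₀⟩·(ϖ^b·σ(ϖ^b))∕h_W`** on `E` (★ `map_glueNorm_eq` pulled back); `glueUnitE_mul_eq` — `r₀·e′ = (−(e′∕⟨w₀,w₀⟩)∕h_W)·((⟨w₀,w₀⟩·ϖ^b)·σ(⟨w₀,w₀⟩·ϖ^b))`
  for `σ⟨w₀,w₀⟩ = ⟨w₀,w₀⟩` (the glue pairing and `(ϖσϖ)^b` collect into ONE norm).
* §3 `exists_norm_mul_norm_iff` — `y ≠ 0 ⇒ ((∃ c, cσc = x·(yσy)) ↔ ∃ c, cσc = x)`; HEAD 2 `prodClass_iff_digitClass` — **`(∃ c, cσc = r₀·e′) ↔ ∃ c, cσc = −(e′∕⟨w₀,w₀⟩)∕h_W`**: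
  the product class of (b) is the class of `−g∕h_W`, `g := e′∕⟨w₀,w₀⟩` the fixed-unit part of `a∕t₊` up to `|⟨w₀,w₀⟩|` (LH4-p13's `Π(Λ) = ω(−g∕h_W)`); the glue pairing's own class CANCELS.
HONEST LABEL.  Count-neutral field algebra; nothing printed is asserted; no census law is stated; ‹PRODBAL›, the MIX-HI letters, (OFF), (ROW), (β₂) stay HYPOTHESES (β₂ UNPROVED);
`HC_CM` is proved only modulo the 7 printed citations (2 remaining named inputs: hLiu418 = `stmt-HodgeConjecture-24832`, h413 = `stmt-HodgeConjecture-24833`) until rung 0 closes.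
## References
* [Jacobowitz1962] R. Jacobowitz, *Hermitian forms over local fields*, Amer. J. Math. 84 (1962): §4 (dual generator, gluing datum).
* [Serre1979] J.-P. Serre, *Local Fields*, GTM 67 (1979): Ch. V §3 Cor. 3 (norm classes), Ch. XIV §3 (local symbols as characters).
* [LanglandsShelstad1987] R. P. Langlands, D. Shelstad, *On the definition of transfer factors*, Math. Ann. 278 (1987): §2.
* [Kottwitz1986BaseChangeUnits] R. E. Kottwitz, *Base change for unit elements of Hecke algebras*, Compositio Math. 60 (1986): §1 pp. 240–241.
-/

set_option autoImplicit false

noncomputable section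

namespace Summit.HodgeConjecture.HodgeConjecture.Cruxes.H413.F0P3cDyRamRayScalarGluePairingE

open scoped WithZero
open Literature.NumberTheory.Automorphic Literature.NumberTheory.Automorphic.HermitianLattice Literature.NumberTheory.Automorphic.UnitaryLatticeTree
open Summit.HodgeConjecture.HodgeConjecture.Cruxes.H413.F0P3cDyRamToricCensusDefs
open Summit.HodgeConjecture.HodgeConjecture.Cruxes.H413.F0P3cDyRamConeLevelTransport (map_glueNorm_eq)
open Summit.HodgeConjecture.HodgeConjecture.Cruxes.H413.F0P3cDyRamRayScalarGluePairing (rayScalar_eq_pairing_mul_affine map_affine_eq_self kappaHat_add_map)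

variable {E M : Type*} [Field E] [Field M] {ρ Θ : M →+* M} {α : M}

/-! ## §1 The ray scalar on `E` -/

/-- The affine digit value `ρμ + (μ − ρμ)·κ̂` (`κ̂ = ρu₀∕(u₀ + ρu₀)`, `Tr_ρ u₀ ≠ 0`) is `ρ`-fixed, hence in `jE(E)`. [cite: Serre1979, Ch. XIV §3] -/
theorem exists_affine_preimage (hρρ : ∀ x, ρ (ρ x) = x) (jE : E →+* M) (hjfix : ∀ z, ρ z = z ↔ ∃ c, jE c = z)
    (μ : M) {u₀ : M} (ht : u₀ + ρ u₀ ≠ 0) :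
    ∃ a : E, jE a = ρ μ + (μ - ρ μ) * (ρ u₀ / (u₀ + ρ u₀)) :=
  (hjfix _).1 (map_affine_eq_self hρρ (kappaHat_add_map hρρ ht))

/-- **HEAD 1 — THE RAY SCALAR ON `E` IS THE GLUE PAIRING TIMES THE AFFINE DIGIT**: `∃ a, jE a = ρμ + (μ − ρμ)κ̂ ∧ e₀ = ⟨w₀,w₀⟩·a` (★ p864387 HEAD′ pulled back along the
injective `jE`; letters = HEAD′'s + `Fix ρ = jE(E)`). [cite: Jacobowitz1962, §4] [cite: LanglandsShelstad1987, §2] -/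
theorem rayScalar_eq_pairing_mul_on_E (hρρ : ∀ x, ρ (ρ x) = x) (hΘΘ : ∀ x, Θ (Θ x) = x) (hΘρ : ∀ x, Θ (ρ x) = ρ (Θ x))
    (σ : E →+* E) (H₂ : Matrix (Fin 2) (Fin 2) E) (jE : E →+* M) (hjfix : ∀ z, ρ z = z ↔ ∃ c, jE c = z) (φ : (Fin 2 → E) →+ M) {h : M} (hΘh : Θ h = h) (hh : h ≠ 0)
    (hform : ∀ x y, jE (pairing σ H₂ x y) = h * Θ (φ x) * φ y + ρ (h * Θ (φ x) * φ y))
    {cc x₀ : M} (hc : ρ cc = cc) (hc0 : cc ≠ 0) (hα : ρ α ≠ α) (hx₀ : x₀ ≠ 0) {w₀ : Fin 2 → E} (hw₀ : φ w₀ = (dualGen ρ Θ α cc h x₀)⁻¹ * x₀)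
    {μ : M} {e₀ : E} (he₀ : jE e₀ = μ / (cc * (α - ρ α) * Θ (dualGen ρ Θ α cc h x₀)) + ρ (μ / (cc * (α - ρ α) * Θ (dualGen ρ Θ α cc h x₀))))
    (ht : h * (x₀ * Θ x₀) + ρ (h * (x₀ * Θ x₀)) ≠ 0) :
    ∃ a : E, jE a = ρ μ + (μ - ρ μ) * (ρ (h * (x₀ * Θ x₀)) / (h * (x₀ * Θ x₀) + ρ (h * (x₀ * Θ x₀)))) ∧ e₀ = pairing σ H₂ w₀ w₀ * a := by
  obtain ⟨a, ha⟩ := exists_affine_preimage hρρ jE hjfix μ ht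
  refine ⟨a, ha, jE.injective ?_⟩
  rw [map_mul, ha]
  exact rayScalar_eq_pairing_mul_affine hρρ hΘΘ hΘρ σ H₂ jE φ hΘh hh hform hc hc0 hα hx₀ hw₀ he₀ ht

/-! ## §2 The glue unit on `E` -/

/-- **THE GLUE UNIT ON `E`**: `jE r₀ = glueUnit(x₀, b)` (`φw₀ = Y⁻¹x₀`, `Θ∘jE = jE∘σ`) gives `r₀ = −⟨w₀,w₀⟩·(ϖ^b·σ(ϖ^b))∕h_W` (★ `map_glueNorm_eq` pulled back).
[cite: Jacobowitz1962, §4] [cite: Kottwitz1986BaseChangeUnits, §1 pp. 240–241] -/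
theorem glueUnitE_eq (σ : E →+* E) (H₂ : Matrix (Fin 2) (Fin 2) E) (jE : E →+* M) (hΘj : ∀ x, Θ (jE x) = jE (σ x)) (φ : (Fin 2 → E) →+ M) {h : M}
    (hform : ∀ x y, jE (pairing σ H₂ x y) = h * Θ (φ x) * φ y + ρ (h * Θ (φ x) * φ y))
    {cc x₀ : M} {w₀ : Fin 2 → E} (hw₀ : φ w₀ = (dualGen ρ Θ α cc h x₀)⁻¹ * x₀) (ϖ hW : E) (b : ℕ)
    {r₀ : E} (hr₀ : jE r₀ = glueUnit ρ Θ α cc h (jE ϖ) (jE hW) x₀ b) :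
    r₀ = -(pairing σ H₂ w₀ w₀) * (ϖ ^ b * σ (ϖ ^ b)) / hW :=
  jE.injective (by rw [hr₀]; exact (map_glueNorm_eq σ H₂ jE hΘj φ hform hw₀ ϖ hW b).symm)

/-- **THE PRODUCT `r₀·e′` COLLECTS THE GLUE PAIRING INTO ONE NORM**: with `σ⟨w₀,w₀⟩ = ⟨w₀,w₀⟩ ≠ 0`, `h_W ≠ 0`,
`r₀·e′ = (−(e′∕⟨w₀,w₀⟩)∕h_W) · ((⟨w₀,w₀⟩·ϖ^b)·σ(⟨w₀,w₀⟩·ϖ^b))`. [cite: Serre1979, Ch. V §3 Cor. 3] -/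
theorem glueUnitE_mul_eq (σ : E →+* E) (H₂ : Matrix (Fin 2) (Fin 2) E) (jE : E →+* M) (hΘj : ∀ x, Θ (jE x) = jE (σ x)) (φ : (Fin 2 → E) →+ M) {h : M}
    (hform : ∀ x y, jE (pairing σ H₂ x y) = h * Θ (φ x) * φ y + ρ (h * Θ (φ x) * φ y))
    {cc x₀ : M} {w₀ : Fin 2 → E} (hw₀ : φ w₀ = (dualGen ρ Θ α cc h x₀)⁻¹ * x₀) (ϖ : E) {hW : E} (hhW : hW ≠ 0) (b : ℕ)
    {r₀ : E} (hr₀ : jE r₀ = glueUnit ρ Θ α cc h (jE ϖ) (jE hW) x₀ b)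
    (hσpw : σ (pairing σ H₂ w₀ w₀) = pairing σ H₂ w₀ w₀) (hpw0 : pairing σ H₂ w₀ w₀ ≠ 0) (e' : E) :
    r₀ * e' = (-(e' / pairing σ H₂ w₀ w₀) / hW) * ((pairing σ H₂ w₀ w₀ * ϖ ^ b) * σ (pairing σ H₂ w₀ w₀ * ϖ ^ b)) := by
  rw [glueUnitE_eq σ H₂ jE hΘj φ hform hw₀ ϖ hW b hr₀, map_mul σ (pairing σ H₂ w₀ w₀) (ϖ ^ b), hσpw]
  field_simp

/-! ## §3 The product class is the digit class -/

omit [Field M] in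
/-- A NORM FACTOR DOES NOT MOVE THE CLASS: for `y ≠ 0` (any ring hom `σ`), `(∃ c, cσc = x·(yσy)) ↔ ∃ c, cσc = x`. [cite: Serre1979, Ch. V §3 Cor. 3] -/
theorem exists_norm_mul_norm_iff {σ : E →+* E} (x : E) {y : E} (hy : y ≠ 0) :
    (∃ c : E, c * σ c = x * (y * σ y)) ↔ ∃ c : E, c * σ c = x := by
  have hσy : σ y ≠ 0 := (map_ne_zero σ).2 hy
  constructor
  · rintro ⟨c, hc⟩
    refine ⟨c / y, ?_⟩
    rw [map_div₀, div_mul_div_comm, hc, mul_div_assoc, div_self (mul_ne_zero hy hσy), mul_one]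
  · rintro ⟨c, hc⟩
    exact ⟨c * y, by rw [map_mul, ← hc]; ring⟩

/-- **HEAD 2 — THE PRODUCT CLASS OF A MEMBER IS THE CLASS OF `−g∕h_W`, `g = e′∕⟨w₀,w₀⟩`**: with the glue letter `jE r₀ = glueUnit(x₀, b)`, `σ⟨w₀,w₀⟩ = ⟨w₀,w₀⟩ ≠ 0`,
`h_W, ϖ ≠ 0`: `(∃ c, cσc = r₀·e′) ↔ ∃ c, cσc = −(e′∕⟨w₀,w₀⟩)∕h_W` — the glue pairing's own class CANCELS in the product (LH4-p13's `Π(Λ) = ω(−g∕h_W)`).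
[cite: Serre1979, Ch. V §3 Cor. 3] [cite: LanglandsShelstad1987, §2] [cite: Kottwitz1986BaseChangeUnits, §1 pp. 240–241] -/
theorem prodClass_iff_digitClass (σ : E →+* E) (H₂ : Matrix (Fin 2) (Fin 2) E) (jE : E →+* M) (hΘj : ∀ x, Θ (jE x) = jE (σ x))
    (φ : (Fin 2 → E) →+ M) {h : M} (hform : ∀ x y, jE (pairing σ H₂ x y) = h * Θ (φ x) * φ y + ρ (h * Θ (φ x) * φ y))
    {cc x₀ : M} {w₀ : Fin 2 → E} (hw₀ : φ w₀ = (dualGen ρ Θ α cc h x₀)⁻¹ * x₀) {ϖ : E} (hϖ0 : ϖ ≠ 0) {hW : E} (hhW : hW ≠ 0) (b : ℕ)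
    {r₀ : E} (hr₀ : jE r₀ = glueUnit ρ Θ α cc h (jE ϖ) (jE hW) x₀ b)
    (hσpw : σ (pairing σ H₂ w₀ w₀) = pairing σ H₂ w₀ w₀) (hpw0 : pairing σ H₂ w₀ w₀ ≠ 0) (e' : E) :
    (∃ c : E, c * σ c = r₀ * e') ↔ ∃ c : E, c * σ c = -(e' / pairing σ H₂ w₀ w₀) / hW := by
  rw [glueUnitE_mul_eq σ H₂ jE hΘj φ hform hw₀ ϖ hhW b hr₀ hσpw hpw0 e']
  exact exists_norm_mul_norm_iff _ (mul_ne_zero hpw0 (pow_ne_zero b hϖ0))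

/-- **COROLLARY — THE EXACT-LEVEL DIGIT ON `E`**: with HEAD 1's `a`, `|e₀| = |⟨w₀,w₀⟩|·|a|`, so «`|e₀| = |ϖ|^{ℓ₀}`» (★ p864839 (a)) is «`|⟨w₀,w₀⟩·a| = |ϖ|^{ℓ₀}`» — a SPHERE
condition on the digit (LH4-p13's `NX`). [cite: Serre1979, Ch. XIV §3] -/
theorem v_rayScalar_eq_iff_of_eq [Valued E ℤᵐ⁰] {e₀ pw a : E} (he : e₀ = pw * a) (R : ℤᵐ⁰) :
    Valued.v e₀ = R ↔ Valued.v pw * Valued.v a = R := by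
  rw [he, Valuation.map_mul]

end Summit.HodgeConjecture.HodgeConjecture.Cruxes.H413.F0P3cDyRamRayScalarGluePairingE

end
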